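/-
Copyright (c) 2026 the pub-hodgecm-mathlib formalisation cell (harness21).  Prover seat hodgecm-mathlib-R90-C133-p02 (g0) for R90-TF section S8 «ContSpec-n½» (planner R90-CS-plan (g2), deal
(B-2) S8-R24 16:52:09Z): the `U(2,1)` twin of ★ `K2E1ChiEisensteinMeromorphicExportsU2GlobalEigen` (the X2_χ core in the generic-eigenvalue currency), over (B-1) ★
`K2E1ChiEisensteinMeromorphicExportsU3Global` §1 (the `N = 3` common-pole-set gluing, R90-CS-p03 (g0)).  h413 = `stmt-HodgeConjecture-24833`, route of record `HCCMUnconditional`.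
-/
import Summits.HodgeConjecture.HodgeConjecture.Theorems.K2E1ChiEisensteinMeromorphicExportsU3Global   -- ★ (B-1): §1 `chiEisenstein_meromorphic_globalPoleSet_of_balls_cm_three` (row 13 at `N = 3`) and, transitively, ★ `K2E1BorelEisensteinRegularCMThree` (`…_cm_three` continuity), ★ P3-D `exists_evalCLM`, ★ X2a `continuous_integral_mul_lift`, ★ `quotFun_lift`
import HarnessLib

/-!
# K2·E1 ∕ R90·S8 — `K2E1ChiEisensteinMeromorphicExportsU3GlobalEigen` ((B-2)): THE X2_χ CORE OF A `χ`-EISENSTEIN FAMILY OF `U(2,1)_{L∕L⁺}` (GLOBAL GLUING OF THE PER-BALL PACKAGES OF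
# `E(f_z^φ)` WITH ONE POLE SET) IN THE GENERIC-EIGENVALUE CURRENCY (`ŝ_{n,i}(z)` entire, in place of the spherical transforms `∫ h_{n,i}·H^z dν_G`)

Cell `pub/hodgecm-mathlib`, crux h413 = `stmt-HodgeConjecture-24833`, route of record `HCCMUnconditional`; R90-TF section S8 «ContSpec-n½» (the `U(Φ₃)` χ-twin programme, K2E1-p16's
TWIN-DAG v1: the eigen-currency feed of row 6, consumed with ★ `K2E1ChiEisensteinBallPackageCMThreeEigen` (row 5, PAIR currency) by the `…U3GlobalCM` assembly).  THEOREMS ONLY (no `def`,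
no `instance`, no `notation`, no named-fact hypothesis, no `sorry`; default heartbeats); lane `--kind proof --supports stmt-HodgeConjecture-24833 --as helper` (count-neutral).  Closes no
socket.

THE TWIN ([BernsteinLapid2019] Thm 2.3, §2.1, §2.4, §4; [MoeglinWaldspurger1995] IV.1.8–IV.1.10).  THIS FILE = ★ `K2E1ChiEisensteinMeromorphicExportsU2GlobalEigen.
chiEisenstein_meromorphic_exports_core_of_packages_of_eigen` VERBATIM with `U(J₂) ↦ U(Φ₃)` (`quasiSplit L⁺ L c 2 ↦ quasiSplit L⁺ L c 3`), the Godement abscissa `1 < Re z ↦ 2 < Re z`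
(pole set `P ⊆ {Re ≤ 1} ↦ P ⊆ {Re ≤ 2}`), ONE extra binder `(hn₀ : 1 ≤ n₀)` (the `σ₀ ≤ n₀ + 1` of the `σ₀`-generic ★ `exists_global_pole_set_of_lt` at `σ₀ = 2`, vacuous at `N = 2`),
and the two `N = 2` pins re-pointed: ★ row 13 `chiEisenstein_meromorphic_globalPoleSet_of_balls` ↦ (B-1) ★ `chiEisenstein_meromorphic_globalPoleSet_of_balls_cm_three`, ★
`continuous_eisensteinSeriesU_flatSectionU_cm_two` ↦ ★ `continuous_eisensteinSeriesU_flatSectionU_cm_three`.  Every other engine is rank-generic ★ (`exists_evalCLM`, `quotFun_lift`,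
`lift_quotientSubgroup_mul`, `continuous_integral_mul_lift`, `HX ∕ toHX ∕ supHeight … N …`).  As at `N = 2`, the eigenvalue functions `ŝ n i` (ENTIRE, letter `hŝ`) replace the spherical
transforms; their continuity is the only property (E5)'s limit step uses.
* **`chiEisenstein_meromorphic_exports_core_of_packages_cm_three_of_eigen`** — (B-1) §1's conclusion VERBATIM (`Ec`, `qc`, ONE common pole set `P ⊆ {Re ≤ 2}`) AND (E5) the pointwise
  representation `Ec z g = ŝ_{n,j}(z)⁻¹ · ∫ h_{n,j}(y) · vX_n(z)[(g y)⁻¹] dν_G` on `U n ∖ P` AND (E4) continuity of `g ↦ Ec z g` off `P`.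
HONEST LABEL: HC_CM is proved only modulo the 7 printed citations (2 remaining named inputs: hLiu418 = `stmt-HodgeConjecture-24832`, h413 = `stmt-HodgeConjecture-24833`) until rung 0
closes; this file asserts no named fact, is conditional by construction on the per-ball letters (`hgerm`, `hcov`, `hF…`, row 5's output), and closes no socket; count-neutral.  NOT claimed:
the location of the poles inside `{Re ≤ 2}`, the constant term of `Ec` off the Godement domain, the functional equation.

## References
* [BernsteinLapid2019] J. Bernstein, E. Lapid, *On the meromorphic continuation of Eisenstein series*, J. Amer. Math. Soc. 37 (2024) (arXiv:1911.02342), Thm 2.3, §2.1, §2.4, §4 pp. 9–10.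
* [MoeglinWaldspurger1995] C. Mœglin, J.-L. Waldspurger, *Spectral Decomposition and Eisenstein Series* (1995), II.1.5, IV.1.8–IV.1.11.
-/

set_option autoImplicit false
-- the mandated namespace repeats `HodgeConjecture.HodgeConjecture`, as in every `Theorems/*.lean` of this sub-problem
set_option linter.dupNamespace false

noncomputable section

open MeasureTheory Filter Topology Set NumberField
open scoped NNReal ENNReal Classical ComplexConjugate
open Literature.MeasureTheory.Group Literature.NumberTheory Literature.NumberTheory.Automorphic Literature.NumberTheory.Automorphic.UnitaryGroup AdelicGroupData
open Summit.HodgeConjecture.HodgeConjecture.Cruxes.H413.K2E1BorelEisensteinU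
open Summit.HodgeConjecture.HodgeConjecture.Cruxes.H413.K2E1BLBorelSpacesU2Defs
open Summit.HodgeConjecture.HodgeConjecture.Cruxes.H413.K2E1BLBorelOperatorsU2Defs
open Summit.HodgeConjecture.HodgeConjecture.Cruxes.H413.K2E1BLEvaluationFunctionalU2 (exists_evalCLM)
open Summit.HodgeConjecture.HodgeConjecture.Cruxes.H413.K2E1BLLiftIntegrabilityU (quotFun_lift lift_quotientSubgroup_mul)
open Summit.HodgeConjecture.HodgeConjecture.Cruxes.H413.K2E1BorelEisensteinRegularCMThree (continuous_eisensteinSeriesU_flatSectionU_cm_three)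
open Summit.HodgeConjecture.HodgeConjecture.Cruxes.H413.K2E1SphericalEisensteinCoefficientCMTwo (continuous_integral_mul_lift)
open Summit.HodgeConjecture.HodgeConjecture.Cruxes.H413.K2E1ChiEisensteinMeromorphicExportsU3Global (chiEisenstein_meromorphic_globalPoleSet_of_balls_cm_three)

namespace Summit.HodgeConjecture.HodgeConjecture.Cruxes.H413.K2E1ChiEisensteinMeromorphicExportsU3GlobalEigen

variable (L : Type) [Field L] [NumberField L] [IsCMField L]
  [MeasurableSpace (quasiSplit (↥(maximalRealSubfield L)) L (IsCMField.complexConj L) 3).Adelic] [BorelSpace (quasiSplit (↥(maximalRealSubfield L)) L (IsCMField.complexConj L) 3).Adelic]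

/-- **(B-2) — GENERIC-EIGENVALUE EDITION AT `N = 3` (`ŝ n i z` for `∫ h_{n,i}·H^z`).** X2_χ CORE — THE GLOBAL BERNSTEIN–LAPID EXPORTS OF A `χ`-EISENSTEIN FAMILY OF `U(2,1)_{L∕L⁺}`, HYPOTHESIS-FIRST ON THE PER-BALL PACKAGES — the twin of ★ `K2E1ChiEisensteinMeromorphicExportsU2GlobalEigen.chiEisenstein_meromorphic_exports_core_of_packages_of_eigen` (`(…2) ↦ (…3)`, `1 < Re ↦ 2 < Re`, `+ (hn₀ : 1 ≤ n₀)`, row 13 ↦ (B-1) §1, `…_cm_two ↦ …_cm_three`).  Data: the measures `μ` (automorphic),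
`ν_G` (Haar, inversion-invariant); a continuous bounded section `φ`; `n₀`; per ball `D_n = ball 0 (n+2)`, `n ≥ n₀`: real test functions `h n j` (continuous, compactly supported,
`conj h = h`) whose height transforms `ĥ_{n,j}` have no common zero on `D_n`; the co-discrete open holomorphy set `U n ⊆ D_n`; the vector solution `vX n : ℂ → 𝓗_{k n}(𝔛)` holomorphic on
`U n`; the scalar pieces `F g n`, meromorphic on `D_n`, `= E(f_z^φ)(g)` on its Godement part, of non-negative order on `U n`, with GERMS IN INTEGRAL FORM
`F g n =ᶠ[𝓝[≠] z] s ↦ ĥ_{n,j}(s)⁻¹·∫ h_{n,j}(y)·vX_n(s)[(g y)⁻¹] dν_G` at every `z ∈ U n` with `ĥ_{n,j}(z) ≠ 0` (X1_χ §1's (R4)-clause at the ★ P3-D functionals); and scalar coefficient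
pieces `Fq j n` against Godement-range functions `q j` exactly as (B-1) §1 (★ row 13 at `N = 3`).  THEN: (B-1) §1's conclusion VERBATIM (`Ec`, `qc`, ONE common pole set `P`) AND (E5) the pointwise
representation of `Ec z g` on `U n ∖ P` AND (E4) the continuity of `g ↦ Ec z g` for every `z ∉ P` — the `N = 3` print of ★ X2_χ core (E5)∕(E4); proof = the ★ `N = 2` proof verbatim.
[cite: BernsteinLapid2019, Thm 2.3, §2.1, §2.4 and §4 Claims 1–5 (pp. 9–10)] [cite: MoeglinWaldspurger1995, IV.1.8–IV.1.10] -/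
theorem chiEisenstein_meromorphic_exports_core_of_packages_cm_three_of_eigen
    (μ : Measure (quasiSplit (↥(maximalRealSubfield L)) L (IsCMField.complexConj L) 3).automorphicQuotient) [(quasiSplit (↥(maximalRealSubfield L)) L (IsCMField.complexConj L) 3).IsAutomorphicMeasure μ]
    (νG : Measure (quasiSplit (↥(maximalRealSubfield L)) L (IsCMField.complexConj L) 3).Adelic) [νG.IsHaarMeasure] [νG.IsInvInvariant] [SFinite νG]
    {φ : (quasiSplit (↥(maximalRealSubfield L)) L (IsCMField.complexConj L) 3).Adelic → ℂ} (hφc : Continuous φ) {M : ℝ} (hφM : ∀ x, ‖φ x‖ ≤ M) (n₀ : ℕ) (hn₀ : 1 ≤ n₀) (k : ℕ → ℕ)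
    -- per ball: the real test functions and the cover of the ball by their height transforms
    {I : ℕ → Type} (h : (n : ℕ) → I n → (quasiSplit (↥(maximalRealSubfield L)) L (IsCMField.complexConj L) 3).Adelic → ℂ) (hhc : ∀ n i, Continuous (h n i)) (hhs : ∀ n i, HasCompactSupport (h n i))
    (hreal : ∀ n i x, conj (h n i x) = h n i x)
    -- the EIGENVALUE FUNCTIONS per ball (entire; ★ convData_χ's `ŝ i`), replacing the spherical transforms `∫ h_{n,i}·H^z`
    (ŝ : (n : ℕ) → I n → ℂ → ℂ) (hŝ : ∀ n i, Differentiable ℂ (ŝ n i))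
    (hcov : ∀ n : ℕ, n₀ ≤ n → ∀ z ∈ Metric.ball (0 : ℂ) (n + 2), ∃ i, (ŝ n i z) ≠ 0)
    -- per ball: the co-discrete open holomorphy set and the vector solution, holomorphic there
    {U : ℕ → Set ℂ} (hUo : ∀ n : ℕ, n₀ ≤ n → IsOpen (U n)) (hUD : ∀ n : ℕ, n₀ ≤ n → U n ⊆ Metric.ball (0 : ℂ) (n + 2))
    (hUcd : ∀ n : ℕ, n₀ ≤ n → ∀ z₀ ∈ Metric.ball (0 : ℂ) (n + 2), ∀ᶠ s in 𝓝[≠] z₀, s ∈ U n)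
    (vX : (n : ℕ) → ℂ → HX (↥(maximalRealSubfield L)) L (IsCMField.complexConj L) 3 (k n) μ) (hvXd : ∀ n : ℕ, n₀ ≤ n → DifferentiableOn ℂ (vX n) (U n))
    -- per ball: the scalar pieces of the Eisenstein family (meromorphic, Godement agreement, order ≥ 0 on `U n`, germs in integral form)
    {F : (quasiSplit (↥(maximalRealSubfield L)) L (IsCMField.complexConj L) 3).Adelic → ℕ → ℂ → ℂ}
    (hF : ∀ g (n : ℕ), n₀ ≤ n → MeromorphicOn (F g n) (Metric.ball (0 : ℂ) (n + 2)))
    (hFE : ∀ g (n : ℕ), n₀ ≤ n → ∀ z ∈ Metric.ball (0 : ℂ) (n + 2), 2 < z.re → F g n z = eisensteinSeriesU (flatSectionU φ z) g)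
    (hFord : ∀ g (n : ℕ), n₀ ≤ n → ∀ z ∈ Metric.ball (0 : ℂ) (n + 2), z ∈ U n → 0 ≤ meromorphicOrderAt (F g n) z)
    (hgerm : ∀ g (n : ℕ), n₀ ≤ n → ∀ j, ∀ z ∈ U n, (ŝ n j z) ≠ 0 →
      F g n =ᶠ[𝓝[≠] z] fun s => (ŝ n j s)⁻¹ * ∫ y, h n j y * ((vX n s : HX (↥(maximalRealSubfield L)) L (IsCMField.complexConj L) 3 (k n) μ) : (quasiSplit (↥(maximalRealSubfield L)) L (IsCMField.complexConj L) 3).automorphicQuotient → ℂ) ((quasiSplit (↥(maximalRealSubfield L)) L (IsCMField.complexConj L) 3).toAutomorphicQuotient (g * y)⁻¹) ∂νG)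
    -- the coefficient pieces (scalar families, (B-1) §1's clauses)
    {J : Type*} {q : J → ℂ → ℂ} (hq : ∀ j, DifferentiableOn ℂ (q j) {z : ℂ | 2 < z.re})
    {Fq : J → ℕ → ℂ → ℂ}
    (hFq : ∀ j (n : ℕ), n₀ ≤ n → MeromorphicOn (Fq j n) (Metric.ball (0 : ℂ) (n + 2)))
    (hFqq : ∀ j (n : ℕ), n₀ ≤ n → ∀ z ∈ Metric.ball (0 : ℂ) (n + 2), 2 < z.re → Fq j n z = q j z)
    (hFqord : ∀ j (n : ℕ), n₀ ≤ n → ∀ z ∈ Metric.ball (0 : ℂ) (n + 2), z ∈ U n → 0 ≤ meromorphicOrderAt (Fq j n) z) :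
    ∃ (Ec : ℂ → (quasiSplit (↥(maximalRealSubfield L)) L (IsCMField.complexConj L) 3).Adelic → ℂ) (qc : J → ℂ → ℂ) (P : Set ℂ),
      (∀ g, MeromorphicNFOn (fun z => Ec z g) univ) ∧ (∀ j, MeromorphicNFOn (qc j) univ) ∧
      (∀ z : ℂ, 2 < z.re → Ec z = eisensteinSeriesU (flatSectionU φ z)) ∧ (∀ j (z : ℂ), 2 < z.re → qc j z = q j z) ∧
      (∀ g (n : ℕ), n₀ ≤ n → ∀ z ∈ Metric.ball (0 : ℂ) (n + 2), (fun z => Ec z g) =ᶠ[𝓝[≠] z] F g n) ∧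
      (∀ j (n : ℕ), n₀ ≤ n → ∀ z ∈ Metric.ball (0 : ℂ) (n + 2), qc j =ᶠ[𝓝[≠] z] Fq j n) ∧
      IsClosed P ∧ (∀ z₀ : ℂ, ∀ᶠ s in 𝓝[≠] z₀, s ∉ P) ∧ (∀ z ∈ P, z.re ≤ 2) ∧
      (∀ z : ℂ, z ∉ P → 2 < z.re ∨ (z ∈ U (max n₀ ⌈‖z‖⌉₊) ∧ z ∈ U (max n₀ (⌈‖z‖⌉₊ + 1)))) ∧
      (∀ g (z : ℂ), z ∉ P → AnalyticAt ℂ (fun z => Ec z g) z) ∧ (∀ j (z : ℂ), z ∉ P → AnalyticAt ℂ (qc j) z) ∧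
      (∀ g, DifferentiableOn ℂ (fun z => Ec z g) Pᶜ) ∧ (∀ j, DifferentiableOn ℂ (qc j) Pᶜ) ∧
      -- (E5) THE POINTWISE REPRESENTATION on `U n ∖ P`
      (∀ g (n : ℕ), n₀ ≤ n → ∀ j, ∀ z ∈ U n, z ∉ P → (ŝ n j z) ≠ 0 →
        Ec z g = (ŝ n j z)⁻¹ * ∫ y, h n j y * ((vX n z : HX (↥(maximalRealSubfield L)) L (IsCMField.complexConj L) 3 (k n) μ) : (quasiSplit (↥(maximalRealSubfield L)) L (IsCMField.complexConj L) 3).automorphicQuotient → ℂ) ((quasiSplit (↥(maximalRealSubfield L)) L (IsCMField.complexConj L) 3).toAutomorphicQuotient (g * y)⁻¹) ∂νG) ∧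
      -- (E4) continuity in `g` off `P`
      ∀ z : ℂ, z ∉ P → Continuous (Ec z) := by
  haveI : νG.IsMulRightInvariant := by rw [← Measure.inv_eq_self νG]; infer_instance
  -- (B-1) §1 = ★ row 13 at `N = 3`: the scalar gluing with ONE common pole set
  obtain ⟨Ec, qc, P, hEcNF, hqcNF, hEcE, hqcq, hEcF, hqcF, hPc, hPcd, hPre, hPU, hEan, hqan, hEdiff, hqdiff⟩ :=
    chiEisenstein_meromorphic_globalPoleSet_of_balls_cm_three L hφM n₀ hn₀ hq hUcd hF hFE hFord hFq hFqq hFqord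
  -- ── (E5) NF-germ equality AT `z ∈ U n ∖ P` with `ĥ_{n,j}(z) ≠ 0` (both sides continuous at `z`, limits along `𝓝[≠] z`) ──
  have hE5 : ∀ g (n : ℕ), n₀ ≤ n → ∀ j, ∀ z ∈ U n, z ∉ P → (ŝ n j z) ≠ 0 →
      Ec z g = (ŝ n j z)⁻¹ * ∫ y, h n j y * ((vX n z : HX (↥(maximalRealSubfield L)) L (IsCMField.complexConj L) 3 (k n) μ) : (quasiSplit (↥(maximalRealSubfield L)) L (IsCMField.complexConj L) 3).automorphicQuotient → ℂ) ((quasiSplit (↥(maximalRealSubfield L)) L (IsCMField.complexConj L) 3).toAutomorphicQuotient (g * y)⁻¹) ∂νG := by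
    intro g n hn j z hzU hzP hne
    have hzb : z ∈ Metric.ball (0 : ℂ) (n + 2) := hUD n hn hzU
    -- the evaluation functional of `(Re h_j, g)` (★ P3-D) and its values on the family in integral form (canonical lift, ★ `quotFun_lift`)
    obtain ⟨Λ, hΛ⟩ := exists_evalCLM μ νG (k n) (h := fun x => (h n j x).re) (Complex.continuous_re.comp (hhc n j)) ((hhs n j).comp_left Complex.zero_re) g
    have hre : ∀ x, ((((h n j x).re : ℝ)) : ℂ) = h n j x := fun x => Complex.conj_eq_iff_re.1 (hreal n j x)
    have hΛv : ∀ s, Λ (vX n s) = ∫ y, h n j y * ((vX n s : HX (↥(maximalRealSubfield L)) L (IsCMField.complexConj L) 3 (k n) μ) : (quasiSplit (↥(maximalRealSubfield L)) L (IsCMField.complexConj L) 3).automorphicQuotient → ℂ) ((quasiSplit (↥(maximalRealSubfield L)) L (IsCMField.complexConj L) 3).toAutomorphicQuotient (g * y)⁻¹) ∂νG := by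
      intro s
      have hmem : MemLp ((quasiSplit (↥(maximalRealSubfield L)) L (IsCMField.complexConj L) 3).quotFun (fun y : (quasiSplit (↥(maximalRealSubfield L)) L (IsCMField.complexConj L) 3).Adelic => ((vX n s : HX (↥(maximalRealSubfield L)) L (IsCMField.complexConj L) 3 (k n) μ) : (quasiSplit (↥(maximalRealSubfield L)) L (IsCMField.complexConj L) 3).automorphicQuotient → ℂ) ((quasiSplit (↥(maximalRealSubfield L)) L (IsCMField.complexConj L) 3).toAutomorphicQuotient y⁻¹))) 2
          (μ.withDensity fun x => (((supHeight (↥(maximalRealSubfield L)) L (IsCMField.complexConj L) 3 x)⁻¹ ^ (2 * k n) : ℝ≥0) : ℝ≥0∞)) := by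
        rw [quotFun_lift]; exact Lp.memLp (vX n s)
      have htoHX : toHX (↥(maximalRealSubfield L)) L (IsCMField.complexConj L) 3 (k n) μ (fun y : (quasiSplit (↥(maximalRealSubfield L)) L (IsCMField.complexConj L) 3).Adelic => ((vX n s : HX (↥(maximalRealSubfield L)) L (IsCMField.complexConj L) 3 (k n) μ) : (quasiSplit (↥(maximalRealSubfield L)) L (IsCMField.complexConj L) 3).automorphicQuotient → ℂ) ((quasiSplit (↥(maximalRealSubfield L)) L (IsCMField.complexConj L) 3).toAutomorphicQuotient y⁻¹)) hmem = vX n s := by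
        have key : ∀ (f : (quasiSplit (↥(maximalRealSubfield L)) L (IsCMField.complexConj L) 3).automorphicQuotient → ℂ) (hf : MemLp f 2 (μ.withDensity fun x => (((supHeight (↥(maximalRealSubfield L)) L (IsCMField.complexConj L) 3 x)⁻¹ ^ (2 * k n) : ℝ≥0) : ℝ≥0∞))),
            f = ((vX n s : HX (↥(maximalRealSubfield L)) L (IsCMField.complexConj L) 3 (k n) μ) : (quasiSplit (↥(maximalRealSubfield L)) L (IsCMField.complexConj L) 3).automorphicQuotient → ℂ) → hf.toLp f = vX n s := by
          rintro f hf rfl; exact Lp.toLp_coeFn _ _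
        exact key _ hmem (quotFun_lift _)
      have e := (hΛ (fun y : (quasiSplit (↥(maximalRealSubfield L)) L (IsCMField.complexConj L) 3).Adelic => ((vX n s : HX (↥(maximalRealSubfield L)) L (IsCMField.complexConj L) 3 (k n) μ) : (quasiSplit (↥(maximalRealSubfield L)) L (IsCMField.complexConj L) 3).automorphicQuotient → ℂ) ((quasiSplit (↥(maximalRealSubfield L)) L (IsCMField.complexConj L) 3).toAutomorphicQuotient y⁻¹)) (lift_quotientSubgroup_mul _) hmem).2
      rw [htoHX] at e
      rw [e]; simp only [hre]
    have hev : (fun z => Ec z g) =ᶠ[𝓝[≠] z] fun s => (ŝ n j s)⁻¹ * Λ (vX n s) :=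
      (hEcF g n hn z hzb).trans ((hgerm g n hn j z hzU hne).trans (Eventually.of_forall fun s => by simp only [hΛv]))
    have hĥc : Continuous fun s : ℂ => (ŝ n j s) := (hŝ n j).continuous
    have hRc : ContinuousAt (fun s => (ŝ n j s)⁻¹ * Λ (vX n s)) z :=
      (hĥc.continuousAt.inv₀ hne).mul (Λ.continuous.continuousAt.comp ((hvXd n hn).continuousOn.continuousAt ((hUo n hn).mem_nhds hzU)))
    have huniq := tendsto_nhds_unique ((hEan g z hzP).continuousAt.continuousWithinAt.tendsto.congr' hev) hRc.continuousWithinAt.tendsto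
    rw [huniq, hΛv]
  -- ── (E4) continuity in `g` off `P`: on `{2 < Re}` it is `E(f_z^φ)` (★ regularity for bounded continuous `φ`); elsewhere (E5) at the ball `max n₀ ⌈‖z‖⌉₊` + ★ X2a `continuous_integral_mul_lift` ──
  have hball : ∀ z : ℂ, z ∈ Metric.ball (0 : ℂ) (((max n₀ ⌈‖z‖⌉₊ : ℕ) : ℝ) + 2) := fun z => by
    rw [Metric.mem_ball, dist_zero_right]
    have h1 : ‖z‖ ≤ (⌈‖z‖⌉₊ : ℝ) := Nat.le_ceil ‖z‖
    have h2 : ((⌈‖z‖⌉₊ : ℕ) : ℝ) ≤ ((max n₀ ⌈‖z‖⌉₊ : ℕ) : ℝ) := by exact_mod_cast le_max_right n₀ ⌈‖z‖⌉₊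
    linarith
  have hE4 : ∀ z : ℂ, z ∉ P → Continuous (Ec z) := by
    intro z hzP
    rcases hPU z hzP with hz1 | ⟨hzU, -⟩
    · rw [hEcE z hz1]; exact continuous_eisensteinSeriesU_flatSectionU_cm_three L hz1 hφc hφM
    · obtain ⟨j, hj⟩ := hcov (max n₀ ⌈‖z‖⌉₊) (le_max_left _ _) z (hball z)
      rw [show Ec z = fun g => Ec z g from rfl, show (fun g => Ec z g) = _ from funext fun g => hE5 g (max n₀ ⌈‖z‖⌉₊) (le_max_left _ _) j z hzU hzP hj]
      exact continuous_const.mul (continuous_integral_mul_lift μ νG (k (max n₀ ⌈‖z‖⌉₊)) (Lp.memLp (vX (max n₀ ⌈‖z‖⌉₊) z)) (hhc _ j) (hhs _ j))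
  exact ⟨Ec, qc, P, hEcNF, hqcNF, hEcE, hqcq, hEcF, hqcF, hPc, hPcd, hPre, hPU, hEan, hqan, hEdiff, hqdiff, hE5, hE4⟩

end Summit.HodgeConjecture.HodgeConjecture.Cruxes.H413.K2E1ChiEisensteinMeromorphicExportsU3GlobalEigen

end
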